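import Summits.Ventures.YMGap.RobustBall.PlaquetteFirstMomentResample
import HarnessLib

/-!
# Venture YMGap, track ROBUST-BALL — the plaquette first moment from ABOVE: the cross terms of the squared staple form

HONEST FRAMING. WHAT THIS IS: a venture file (cell `pub-ymgap`, track Y2, seat rb-p2 g6): Haar-measure
identities for the squared staple form at a link `e` of `ℤ^d` (the algebraic half of the UPPER bound on
the plaquette of every DLR state, `PlaquetteUpperMoment`). WHAT IT IS NOT: nothing about the continuum
limit, a spectral gap, or a Clay-sense mass gap; no number of the cell.

With `X_p(g; η) = Re tr(ρ(g) ρ(staple_p^e(η)))` for a plaquette `p ∋ e` (`G ≅ SU(N)`, `V₀ = charVariance ρ`):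
* `integral_sq_sum_eq_card_add_cross` — `∫ (∑_{p ∈ S} X_p)² dg = #S · V₀ + ∑_{p ≠ q ∈ S} C_{pq}`,
  `C_{pq}(η) = ∫ X_p X_q dg` (diagonal `∫ X_p² = V₀`, `integral_term_mul_self`);
* `abs_cross_le` — `|C_{pq}| ≤ V₀` (`|ab| ≤ (a² + b²)/2`);
* `integral_cross_update_eq_zero` — resampling the PRIVATE link `f` of `p` (rb-p2 g6
  `PlaquetteFirstMoment.exists_resampling_link`, privacy `staple_update_eq_of_ne`) by Haar measure kills
  the cross term: `∫ C_{pq}(η^{f←h}) dh = 0` (`∫ Re tr ρ((ga) h b) dh = 0`);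
* `measurable_cross` — `C_{pq}` is a measurable observable.

Everything here is proved; no definition, no named fact. [folklore]
-/

noncomputable section

open MeasureTheory Filter Topology Finset
open Literature.Probability.LatticeModels Literature.Probability.LatticeModels.DobrushinMetric
open Literature.MathematicalPhysics.QuantumLattice Literature.MathematicalPhysics.QuantumFieldTheory

namespace Summit.Ventures.YMGap.RobustBall

namespace PlaquetteCrossTerms

open PlaquettePositivity PlaquetteFirstMoment

/-! ### Part B — the squared staple form expanded: diagonal `V₀` per plaquette plus cross terms -/

section Expand

variable {d N : ℕ} {G : Type*} [Group G] [TopologicalSpace G] [IsTopologicalGroup G]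
  [CompactSpace G] [MeasurableSpace G] [BorelSpace G] (ρ : G →* Matrix (Fin N) (Fin N) ℂ)

omit [CompactSpace G] [MeasurableSpace G] [BorelSpace G] in
/-- One term of the staple form, `g ↦ Re tr(ρ(g) ρ(staple_p^e(η)))`, is continuous. [folklore] -/
theorem continuous_term (hρ : Continuous ρ) (p : ZdPlaquette d)
    (e : Literature.MathematicalPhysics.QuantumLattice.ZdEdge d) (η : LGConfig d G) :
    Continuous fun g : G => (ρ g * ρ (staple p e η)).trace.re := by
  simp_rw [← map_mul]
  exact (continuous_trace_re ρ hρ).comp (continuous_id.mul continuous_const)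

/-- The diagonal term is the character variance: `∫ Re tr(ρ(g)ρ(s))² dg = V₀`. [folklore] -/
theorem integral_term_mul_self (hρ : Continuous ρ) (p : ZdPlaquette d)
    (e : Literature.MathematicalPhysics.QuantumLattice.ZdEdge d) (η : LGConfig d G) :
    ∫ g, (ρ g * ρ (staple p e η)).trace.re * (ρ g * ρ (staple p e η)).trace.re ∂haarProbability G =
      PlaquetteLowerBound.charVariance ρ := by
  have h := integral_reTr_mul_mul_sq ρ hρ 1 (staple p e η)
  simp_rw [one_mul, map_mul] at h
  rw [← h]
  exact integral_congr_ae (ae_of_all _ fun g => by ring)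

/-- **The cross terms are bounded by `V₀`**: `|∫ X_p X_q dg| ≤ ∫ (X_p² + X_q²)/2 dg = V₀`. [folklore] -/
theorem abs_cross_le (hρ : Continuous ρ) (p q : ZdPlaquette d)
    (e : Literature.MathematicalPhysics.QuantumLattice.ZdEdge d) (η : LGConfig d G) :
    |∫ g, (ρ g * ρ (staple p e η)).trace.re * (ρ g * ρ (staple q e η)).trace.re ∂haarProbability G| ≤
      PlaquetteLowerBound.charVariance ρ := by
  set X : G → ℝ := fun g => (ρ g * ρ (staple p e η)).trace.re with hX
  set Y : G → ℝ := fun g => (ρ g * ρ (staple q e η)).trace.re with hY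
  have hXc : Continuous X := continuous_term ρ hρ p e η
  have hYc : Continuous Y := continuous_term ρ hρ q e η
  have hiXX : Integrable (fun g => X g * X g) (haarProbability G) :=
    (hXc.mul hXc).integrable_of_hasCompactSupport (HasCompactSupport.of_compactSpace _)
  have hiYY : Integrable (fun g => Y g * Y g) (haarProbability G) :=
    (hYc.mul hYc).integrable_of_hasCompactSupport (HasCompactSupport.of_compactSpace _)
  have hdX : ∫ g, X g * X g ∂haarProbability G = PlaquetteLowerBound.charVariance ρ :=
    integral_term_mul_self ρ hρ p e η
  have hdY : ∫ g, Y g * Y g ∂haarProbability G = PlaquetteLowerBound.charVariance ρ :=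
    integral_term_mul_self ρ hρ q e η
  show |∫ g, X g * Y g ∂haarProbability G| ≤ PlaquetteLowerBound.charVariance ρ
  calc |∫ g, X g * Y g ∂haarProbability G| ≤ ∫ g, |X g * Y g| ∂haarProbability G :=
        abs_integral_le_integral_abs
    _ ≤ ∫ g, (X g * X g + Y g * Y g) / 2 ∂haarProbability G := by
        refine integral_mono_of_nonneg (ae_of_all _ fun g => abs_nonneg _) ((hiXX.add hiYY).div_const 2)
          (ae_of_all _ fun g => ?_)
        dsimp only
        rw [abs_mul]
        nlinarith [sq_nonneg (|X g| - |Y g|), sq_abs (X g), sq_abs (Y g), abs_nonneg (X g),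
          abs_nonneg (Y g)]
    _ = PlaquetteLowerBound.charVariance ρ := by
        rw [integral_div, integral_add hiXX hiYY, hdX, hdY]; ring

/-- **The squared partial staple form expanded**: for a finite set `S` of plaquettes,
`∫ (∑_{p ∈ S} X_p)² dg = #S · V₀ + ∑_{p ∈ S} ∑_{q ∈ S ∖ p} ∫ X_p X_q dg`
(`X_p(g) = Re tr(ρ(g)ρ(staple_p^e(η)))`, diagonal `∫ X_p² = V₀`). [folklore] -/
theorem integral_sq_sum_eq_card_add_cross (hρ : Continuous ρ)
    (e : Literature.MathematicalPhysics.QuantumLattice.ZdEdge d) (S : Finset (ZdPlaquette d))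
    (η : LGConfig d G) :
    ∫ g, (∑ p ∈ S, (ρ g * ρ (staple p e η)).trace.re) ^ 2 ∂haarProbability G =
      S.card * PlaquetteLowerBound.charVariance ρ +
        ∑ p ∈ S, ∑ q ∈ S.erase p,
          ∫ g, (ρ g * ρ (staple p e η)).trace.re * (ρ g * ρ (staple q e η)).trace.re
            ∂haarProbability G := by
  set X : ZdPlaquette d → G → ℝ := fun p g => (ρ g * ρ (staple p e η)).trace.re with hX
  have hXc : ∀ p, Continuous (X p) := fun p => continuous_term ρ hρ p e η
  have hXi : ∀ p q, Integrable (fun g => X p g * X q g) (haarProbability G) := fun p q =>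
    ((hXc p).mul (hXc q)).integrable_of_hasCompactSupport (HasCompactSupport.of_compactSpace _)
  show ∫ g, (∑ p ∈ S, X p g) ^ 2 ∂haarProbability G =
    S.card * PlaquetteLowerBound.charVariance ρ +
      ∑ p ∈ S, ∑ q ∈ S.erase p, ∫ g, X p g * X q g ∂haarProbability G
  have hsq : ∀ g, (∑ p ∈ S, X p g) ^ 2 = ∑ p ∈ S, ∑ q ∈ S, X p g * X q g := fun g => by
    rw [sq, Finset.sum_mul_sum]
  have h1 : ∫ g, (∑ p ∈ S, X p g) ^ 2 ∂haarProbability G =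
      ∑ p ∈ S, ∑ q ∈ S, ∫ g, X p g * X q g ∂haarProbability G := by
    simp_rw [hsq]
    rw [integral_finsetSum _ fun p _ => integrable_finsetSum _ fun q _ => hXi p q]
    exact Finset.sum_congr rfl fun p _ => integral_finsetSum _ fun q _ => hXi p q
  have hdiag : ∀ p, ∫ g, X p g * X p g ∂haarProbability G = PlaquetteLowerBound.charVariance ρ :=
    fun p => integral_term_mul_self ρ hρ p e η
  have h2 : ∀ p ∈ S, ∑ q ∈ S, ∫ g, X p g * X q g ∂haarProbability G =
      PlaquetteLowerBound.charVariance ρ + ∑ q ∈ S.erase p, ∫ g, X p g * X q g ∂haarProbability G :=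
    fun p hp => by rw [← Finset.add_sum_erase S _ hp, hdiag]
  rw [h1, Finset.sum_congr rfl h2, Finset.sum_add_distrib, Finset.sum_const, nsmul_eq_mul]

variable [SecondCountableTopology G]

/-- **Resampling the private link kills the cross term**: if `f ≠ e` is a link of `p` at which the
staple of `p` at `e` is `a·h·b`, and `q ≠ p` is another plaquette through `e` (whose staple does not
read `f`), then `∫∫ X_p(g; η^{f←h}) X_q(g; η^{f←h}) dg dh = 0` (`∫ Re tr ρ((ga) h b) dh = 0`).
[folklore] -/
theorem integral_cross_update_eq_zero (hρ : IsSpecialUnitaryModel ρ) (hN : 2 ≤ N)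
    {e f : Literature.MathematicalPhysics.QuantumLattice.ZdEdge d} {p q : ZdPlaquette d}
    (hep : e ∈ plaquetteEdges p) (hfp : f ∈ plaquetteEdges p) (hfe : f ≠ e)
    (heq : e ∈ plaquetteEdges q) (hqp : q ≠ p) (η : LGConfig d G) {a b : G}
    (hst : ∀ h : G, staple p e (Function.update η f h) = a * h * b) :
    ∫ h, ∫ g, (ρ g * ρ (staple p e (Function.update η f h))).trace.re *
        (ρ g * ρ (staple q e (Function.update η f h))).trace.re
          ∂haarProbability G ∂haarProbability G = 0 := by
  have hq : ∀ h : G, staple q e (Function.update η f h) = staple q e η := fun h =>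
    staple_update_eq_of_ne hep hfp hfe heq hqp η h
  simp_rw [hst, hq]
  have hrew : ∀ h g : G, (ρ g * ρ (a * h * b)).trace.re = (ρ (g * a * h * b)).trace.re := by
    intro h g; rw [← map_mul]; simp only [mul_assoc]
  simp_rw [hrew]
  set Y : G → ℝ := fun g => (ρ g * ρ (staple q e η)).trace.re with hY
  have hYc : Continuous Y := continuous_term ρ hρ.1 q e η
  have hFc : Continuous fun z : G × G => (ρ (z.2 * a * z.1 * b)).trace.re * Y z.2 :=
    ((continuous_trace_re ρ hρ.1).comp
      (((continuous_snd.mul continuous_const).mul continuous_fst).mul continuous_const)).mul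
      (hYc.comp continuous_snd)
  have hFi : Integrable (Function.uncurry fun h g : G => (ρ (g * a * h * b)).trace.re * Y g)
      ((haarProbability G).prod (haarProbability G)) :=
    hFc.integrable_of_hasCompactSupport (HasCompactSupport.of_compactSpace _)
  rw [integral_integral_swap hFi]
  have hinner : ∀ g : G, ∫ h, (ρ (g * a * h * b)).trace.re * Y g ∂haarProbability G = 0 := fun g => by
    rw [integral_mul_const, integral_reTr_mul_mul_eq_zero ρ hρ hN (g * a) b, zero_mul]
  simp_rw [hinner]
  simp

/-- The cross term `η ↦ ∫ X_p(g; η) X_q(g; η) dg` is a measurable observable. [folklore] -/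
theorem measurable_cross (hρ : Continuous ρ) (p q : ZdPlaquette d)
    (e : Literature.MathematicalPhysics.QuantumLattice.ZdEdge d) :
    Measurable fun η : LGConfig d G =>
      ∫ g, (ρ g * ρ (staple p e η)).trace.re * (ρ g * ρ (staple q e η)).trace.re ∂haarProbability G := by
  have hF : Continuous fun z : LGConfig d G × G =>
      (ρ z.2 * ρ (staple p e z.1)).trace.re * (ρ z.2 * ρ (staple q e z.1)).trace.re := by
    have hc : ∀ r : ZdPlaquette d, Continuous fun z : LGConfig d G × G => (ρ z.2 * ρ (staple r e z.1)).trace.re :=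
      fun r => by
        simp_rw [← map_mul]
        exact (continuous_trace_re ρ hρ).comp (continuous_snd.mul ((continuous_staple r e).comp continuous_fst))
    exact (hc p).mul (hc q)
  exact (hF.stronglyMeasurable.integral_prod_right' (ν := haarProbability G)).measurable

end Expand

end PlaquetteCrossTerms

end Summit.Ventures.YMGap.RobustBall
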